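import Summits.NavierStokesRegularity.NavierStokesRegularity.Theorems.RecurrentProfilesRecurrentLiouvilleLebL3BackwardLiouville
import Summits.NavierStokesRegularity.NavierStokesRegularity.Theorems.SqueezeCycleRecurrentLiouvilleNearIdentityDSS
import Literature.Analysis.FluidPDE.ScalingUniformRecurrence
import Literature.Analysis.FluidPDE.TaoQuantitativeReduction
import HarnessLib

/-!
# Crux `RecurrentLiouville` (stmt-NavierStokesRegularity-1589), line `Sketch` (v8 "Lebesgue rungs") —
  stub H: the DSS Liouville theorem for every factor under an `L³` period

`stub_lebDSSPeriodL3`: let `(u, p)` be a suitable weak solution of Navier–Stokes (`ν = 1`, `f = 0`)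
on the backward slab `ℝ³ × ℝ₋ = (-∞, 0) × ℝ³` with weak gradient `G`, Albritton–Barker quantity
`𝐈(ℝ³ × ℝ₋) < ∞` and the Type-I rate `‖u(t, x)‖ ≤ C/√(−t)`, which is `λ`-discretely self-similar
almost everywhere (`λ u(λ²t, λx) = u(t, x)` for a.e. `(t, x)` in the slab) for some factor `λ > 1`.
If the slices `u(t)` are bounded in `L³(ℝ³)` for almost every time `t` of ONE period
`(λ²T, T)`, `T < 0`, then `u = 0` almost everywhere on the slab.  This is the discretely
self-similar extension of the `L³` exclusion of backward self-similar profiles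
(Nečas–Růžička–Šverák 1996, Thm 1; Tsai 1998, Thm 1), run on the Albritton–Barker engine
(Albritton–Barker 2019, Thm 1.2, here through the landed rung `stub_lebL3BackwardLiouville`).

Proof (pure bookkeeping over landed theorems).
* Slice form of the a.e. self-similarity: `u_{λⁿ} = u` and `u_{λ⁻ⁿ} = u` a.e. on the slab for every
  `n : ℕ` (`rlNearIdentityDSS_ae_pow`, `rlNearIdentityDSS_ae_inv`), hence by Fubini
  (`lebL3B_ae_slice_ae_eq`) for a.e. `t < 0` and all `n`, `u(t) = u_{λ^{±n}}(t)` a.e. in space, so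
  `‖u(t)‖₃ = ‖u_{λ^{±n}}(t)‖₃ = ‖u(λ^{±2n} t)‖₃` (`L³(ℝ³)` is scale invariant,
  `eLpNorm_nsRescale_three`).
* The `L³` bound on the period is transported along the dilations `t ↦ λ^{±2n} t` of the time axis,
  which map null sets to null sets (`Real.volume_preimage_mul_left`); the two endpoints are null.
* Every `t < 0` lies in a period `λ^{2n}`-times or `λ^{-2(n+1)}`-times the given one
  (`exists_nat_pow_near`, `exists_nat_pow_near_of_lt_one` for `t/T`), so `‖u(t)‖₃ ≤ M` for a.e.
  `t < 0`, and `stub_lebL3BackwardLiouville` (with `T₀ = 0`) concludes.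

## References

* J. Nečas, M. Růžička, V. Šverák, *On Leray's self-similar solutions of the Navier–Stokes
  equations*, Acta Math. 176 (1996), 283–294, Thm 1. [NecasRuzickaSverak1996]
* T.-P. Tsai, *On Leray's self-similar solutions of the Navier–Stokes equations satisfying local
  energy estimates*, Arch. Rational Mech. Anal. 143 (1998), 29–51, Thm 1. [Tsai1998]
* D. Albritton, T. Barker, *On local Type I singularities of the Navier–Stokes equations and
  Liouville theorems*, J. Math. Fluid Mech. 21 (2019) no. 43 = arXiv:1811.00502, Thm 1.2.
  [AlbrittonBarker2019]
-/

noncomputable section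

-- the sub-problem namespace repeats the summit name (D-0017 layout `Summit.<S>.<P>.Theorems`)
set_option linter.dupNamespace false

namespace Summit.NavierStokesRegularity.NavierStokesRegularity.Theorems

open MeasureTheory Set Function Filter Topology TopologicalSpace Metric
open Literature.Analysis Literature.Analysis.FluidPDE
open scoped NNReal ENNReal

/-! ## A.e. bookkeeping on the time axis -/

/-- **Dilations of the time axis preserve a.e. statements.**  If `P t` holds for a.e. real `t`, then
`P (a t)` holds for a.e. real `t` (`a ≠ 0`): the exceptional set of the latter is the preimage of a
null set under `t ↦ a t`, of measure `|a⁻¹| · 0` (`Real.volume_preimage_mul_left`). [folklore] -/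
theorem lebDSS_ae_comp_mul_left {P : ℝ → Prop} {a : ℝ} (ha : a ≠ 0)
    (h : ∀ᵐ t ∂(volume : Measure ℝ), P t) : ∀ᵐ t ∂(volume : Measure ℝ), P (a * t) := by
  rw [ae_iff] at h ⊢
  have e : {t | ¬ P (a * t)} = (fun x => a * x) ⁻¹' {t | ¬ P t} := rfl
  rw [e, Real.volume_preimage_mul_left ha, h, mul_zero]

/-- **Closing a period.**  An a.e. statement on the open period `(λ²T, T)` holds a.e. on the closed
period `[λ²T, T]`: the two endpoints are Lebesgue null (`Measure.ae_ne`). [folklore] -/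
theorem lebDSS_ae_period_closed {P : ℝ → Prop} {a T : ℝ}
    (h : ∀ᵐ t ∂(volume : Measure ℝ), a < t → t < T → P t) :
    ∀ᵐ t ∂(volume : Measure ℝ), a ≤ t → t ≤ T → P t := by
  filter_upwards [h, Measure.ae_ne volume a, Measure.ae_ne volume T] with t ht hta htT
  intro h1 h2
  exact ht (lt_of_le_of_ne h1 hta.symm) (lt_of_le_of_ne h2 htT)

/-! ## Period bookkeeping: every negative time is a dilate of a time in the given period -/

/-- **Far past.**  If `L^n ≤ t/T < L^{n+1}` (`L > 0`, `T < 0`), then the dilate `(L^n)⁻¹ t` lies in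
the closed period `[LT, T]`. [folklore] -/
theorem lebDSS_period_far {L T t : ℝ} (hL : 0 < L) (hT : T < 0) {n : ℕ}
    (h1 : L ^ n ≤ t / T) (h2 : t / T < L ^ (n + 1)) :
    L * T ≤ (L ^ n)⁻¹ * t ∧ (L ^ n)⁻¹ * t ≤ T := by
  have hLn : 0 < L ^ n := pow_pos hL n
  refine ⟨?_, ?_⟩
  · rw [le_inv_mul_iff₀ hLn]
    have h3 : L ^ (n + 1) * T < t := (div_lt_iff_of_neg hT).1 h2
    have e : L ^ n * (L * T) = L ^ (n + 1) * T := by rw [pow_succ]; ring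
    rw [e]
    exact h3.le
  · rw [inv_mul_le_iff₀ hLn]
    exact (le_div_iff_of_neg hT).1 h1

/-- **Near past.**  If `L⁻¹^{n+1} < t/T ≤ L⁻¹^n` (`L > 0`, `T < 0`), then the dilate `L^{n+1} t` lies
in the closed period `[LT, T]`. [folklore] -/
theorem lebDSS_period_near {L T t : ℝ} (hL : 0 < L) (hT : T < 0) {n : ℕ}
    (h1 : L⁻¹ ^ (n + 1) < t / T) (h2 : t / T ≤ L⁻¹ ^ n) :
    L * T ≤ L ^ (n + 1) * t ∧ L ^ (n + 1) * t ≤ T := by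
  have hLn : 0 < L ^ (n + 1) := pow_pos hL (n + 1)
  refine ⟨?_, ?_⟩
  · have h3 : L⁻¹ ^ n * T ≤ t := (div_le_iff_of_neg hT).1 h2
    have h4 : L ^ (n + 1) * (L⁻¹ ^ n * T) ≤ L ^ (n + 1) * t :=
      mul_le_mul_of_nonneg_left h3 hLn.le
    have e : L ^ (n + 1) * (L⁻¹ ^ n * T) = L * T := by
      rw [inv_pow, pow_succ, ← mul_assoc, mul_right_comm (L ^ n) L, mul_inv_cancel₀ (pow_pos hL n).ne',
        one_mul]
    rw [e] at h4
    exact h4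
  · have h3 : t < L⁻¹ ^ (n + 1) * T := (lt_div_iff_of_neg hT).1 h1
    have h4 : L ^ (n + 1) * t < L ^ (n + 1) * (L⁻¹ ^ (n + 1) * T) :=
      mul_lt_mul_of_pos_left h3 hLn
    have e : L ^ (n + 1) * (L⁻¹ ^ (n + 1) * T) = T := by
      rw [inv_pow, ← mul_assoc, mul_inv_cancel₀ hLn.ne', one_mul]
    rw [e] at h4
    exact h4.le

/-! ## Slices of an a.e. discretely self-similar field -/

/-- **Slice form of an a.e. discrete self-similarity.**  If `u_c = u` a.e. on the slab
(`c > 0`), then for a.e. `t < 0` the slices agree a.e. in space, `u_c(t) = u(t)`, whence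
`‖u(t)‖_{L³} = ‖u(c² t)‖_{L³}` by the scale invariance of `L³(ℝ³)` (`eLpNorm_nsRescale_three`).
[cite: NecasRuzickaSverak1996, Thm 1 (the `L³` norm of a self-similar slice is scale invariant)] -/
theorem lebDSS_slice_eLpNorm_eq {u : ℝ → EuclideanSpace ℝ (Fin 3) → EuclideanSpace ℝ (Fin 3)} {c : ℝ}
    (hc : 0 < c)
    (h : ∀ᵐ z ∂(volume.restrict (Iio (0 : ℝ) ×ˢ (univ : Set (EuclideanSpace ℝ (Fin 3))))),
      nsRescale c u z.1 z.2 = u z.1 z.2) :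
    ∀ᵐ t ∂((volume : Measure ℝ).restrict (Iio 0)),
      eLpNorm (u t) 3 volume = eLpNorm (u (c ^ 2 * t)) 3 volume := by
  have hsl : ∀ᵐ t ∂((volume : Measure ℝ).restrict (Iio 0)), nsRescale c u t =ᵐ[volume] u t :=
    lebL3B_ae_slice_ae_eq (u := nsRescale c u) (v := u) h
  filter_upwards [hsl] with t ht
  rw [← eLpNorm_congr_ae ht, eLpNorm_nsRescale_three u hc t]

/-! ## Stub H — the DSS Liouville theorem for every factor under an `L³` period -/

/-- **H — DSS Liouville for every factor under an `L³` period** (the discretely self-similar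
extension of Nečas–Růžička–Šverák 1996, Thm 1 / Tsai 1998, Thm 1, on the Albritton–Barker engine).
A suitable weak solution `(u,p)` on `ℝ³ × ℝ₋` with weak gradient `G`, `𝐈 < ⊤` and the rate `C`,
`λ`-discretely self-similar a.e. for some `λ > 1`, whose slices are bounded in `L³(ℝ³)` for a.e. time
of one period `(λ²T, T)`, `T < 0`, vanishes a.e. on the slab: by the slice form of the
self-similarity and the scale invariance of `L³` (`lebDSS_slice_eLpNorm_eq` for the factors
`λ^{±n}`), the bound propagates to a.e. `t < 0` (every negative time is a `λ^{2k}`-dilate, `k ∈ ℤ`, of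
a time of the closed period; dilations preserve null sets), and the backward `L³` rung
`stub_lebL3BackwardLiouville` (Albritton–Barker 2019, Thm 1.2 in the class) concludes.
[cite: NecasRuzickaSverak1996, Thm 1; AlbrittonBarker2019, Thm 1.2] -/
theorem stub_lebDSSPeriodL3 :
    ∀ (lam : ℝ), 1 < lam →
    ∀ (C : ℝ) (u : ℝ → EuclideanSpace ℝ (Fin 3) → EuclideanSpace ℝ (Fin 3))
      (p : ℝ → EuclideanSpace ℝ (Fin 3) → ℝ)
      (G : ℝ → EuclideanSpace ℝ (Fin 3) → EuclideanSpace ℝ (Fin 3) →L[ℝ] EuclideanSpace ℝ (Fin 3)),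
      IsSuitableWeakSolutionOn (slab (EuclideanSpace ℝ (Fin 3)) (Iio 0) isOpen_Iio) 1 0 u p →
      HasWeakSpatialGradientOn (slab (EuclideanSpace ℝ (Fin 3)) (Iio 0) isOpen_Iio) u G →
      typeIBound (Iio (0 : ℝ) ×ˢ univ) u p G < ⊤ →
      HasTypeITimeDecay C u →
      (∀ᵐ z ∂(volume.restrict (Iio (0 : ℝ) ×ˢ (univ : Set (EuclideanSpace ℝ (Fin 3))))),
        nsRescale lam u z.1 z.2 = u z.1 z.2) →
      (∃ (M : ℝ≥0∞) (T : ℝ), M < ⊤ ∧ T < 0 ∧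
        ∀ᵐ t ∂(volume : Measure ℝ), lam ^ 2 * T < t → t < T → eLpNorm (u t) 3 volume ≤ M) →
      ∀ᵐ z ∂(volume.restrict (Iio (0 : ℝ) ×ˢ (univ : Set (EuclideanSpace ℝ (Fin 3))))),
        uncurry u z = (0 : ℝ × EuclideanSpace ℝ (Fin 3) → EuclideanSpace ℝ (Fin 3)) z := by
  intro lam hlam C u p G hsw hwg hI hdec hdss hL3
  obtain ⟨M, T, hM, hT, hbd⟩ := hL3
  have hlam0 : 0 < lam := zero_lt_one.trans hlam
  have hL : 0 < lam ^ 2 := pow_pos hlam0 2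
  have hL1 : 1 < lam ^ 2 := one_lt_pow₀ hlam two_ne_zero
  -- a.e. self-similarity for the factors `λⁿ` and `λ⁻ⁿ`
  have hpow : ∀ n : ℕ, ∀ᵐ z ∂(volume.restrict (Iio (0 : ℝ) ×ˢ (univ : Set (EuclideanSpace ℝ (Fin 3))))),
      nsRescale (lam ^ n) u z.1 z.2 = u z.1 z.2 := rlNearIdentityDSS_ae_pow hlam0 hdss
  have hipow : ∀ n : ℕ, ∀ᵐ z ∂(volume.restrict (Iio (0 : ℝ) ×ˢ (univ : Set (EuclideanSpace ℝ (Fin 3))))),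
      nsRescale (lam⁻¹ ^ n) u z.1 z.2 = u z.1 z.2 :=
    rlNearIdentityDSS_ae_pow (inv_pos.2 hlam0) (rlNearIdentityDSS_ae_inv hlam0 hdss)
  -- slice form: `‖u(t)‖₃ = ‖u(λ^{±2n} t)‖₃` for a.e. `t < 0`, all `n`
  have hA : ∀ᵐ t ∂((volume : Measure ℝ).restrict (Iio 0)), ∀ n : ℕ,
      eLpNorm (u t) 3 volume = eLpNorm (u ((lam ^ 2) ^ n * t)) 3 volume := by
    rw [ae_all_iff]
    intro n
    have h := lebDSS_slice_eLpNorm_eq (pow_pos hlam0 n) (hpow n)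
    rwa [← pow_mul, mul_comm, pow_mul] at h
  have hB : ∀ᵐ t ∂((volume : Measure ℝ).restrict (Iio 0)), ∀ n : ℕ,
      eLpNorm (u t) 3 volume = eLpNorm (u (((lam ^ 2) ^ n)⁻¹ * t)) 3 volume := by
    rw [ae_all_iff]
    intro n
    have h := lebDSS_slice_eLpNorm_eq (pow_pos (inv_pos.2 hlam0) n) (hipow n)
    rwa [inv_pow, inv_pow, ← pow_mul, mul_comm, pow_mul] at h
  -- the bound on the closed period, transported along the dilations of the time axis
  have hbd' : ∀ᵐ t ∂(volume : Measure ℝ), lam ^ 2 * T ≤ t → t ≤ T → eLpNorm (u t) 3 volume ≤ M :=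
    lebDSS_ae_period_closed hbd
  have hC : ∀ᵐ t ∂(volume : Measure ℝ), ∀ n : ℕ, lam ^ 2 * T ≤ (lam ^ 2) ^ n * t →
      (lam ^ 2) ^ n * t ≤ T → eLpNorm (u ((lam ^ 2) ^ n * t)) 3 volume ≤ M := by
    rw [ae_all_iff]
    intro n
    exact lebDSS_ae_comp_mul_left (pow_pos hL n).ne' hbd'
  have hD : ∀ᵐ t ∂(volume : Measure ℝ), ∀ n : ℕ, lam ^ 2 * T ≤ ((lam ^ 2) ^ n)⁻¹ * t →
      ((lam ^ 2) ^ n)⁻¹ * t ≤ T → eLpNorm (u (((lam ^ 2) ^ n)⁻¹ * t)) 3 volume ≤ M := by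
    rw [ae_all_iff]
    intro n
    exact lebDSS_ae_comp_mul_left (inv_pos.2 (pow_pos hL n)).ne' hbd'
  -- the bound for a.e. `t < 0`
  have hgood : ∀ᵐ t ∂(volume : Measure ℝ), t < 0 → eLpNorm (u t) 3 volume ≤ M := by
    have h : ∀ᵐ t ∂((volume : Measure ℝ).restrict (Iio 0)), eLpNorm (u t) 3 volume ≤ M := by
      filter_upwards [hA, hB, ae_restrict_of_ae hC, ae_restrict_of_ae hD,
        ae_restrict_mem measurableSet_Iio] with t htA htB htC htD ht
      have ht0 : t < 0 := ht
      have hs : 0 < t / T := div_pos_of_neg_of_neg ht0 hT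
      rcases le_or_gt 1 (t / T) with hs1 | hs1
      · -- far past: `t ≤ T`, dilate by `λ^{-2n}`
        obtain ⟨n, h1, h2⟩ := exists_nat_pow_near hs1 hL1
        obtain ⟨e1, e2⟩ := lebDSS_period_far hL hT h1 h2
        rw [htB n]
        exact htD n e1 e2
      · -- near past: `T < t < 0`, dilate by `λ^{2(n+1)}`
        obtain ⟨n, h1, h2⟩ := exists_nat_pow_near_of_lt_one hs hs1.le (inv_pos.2 hL)
          (inv_lt_one_of_one_lt₀ hL1)
        obtain ⟨e1, e2⟩ := lebDSS_period_near hL hT h1 h2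
        rw [htA (n + 1)]
        exact htC (n + 1) e1 e2
    have h' := (ae_restrict_iff' measurableSet_Iio).1 h
    filter_upwards [h'] with t ht
    exact ht
  exact stub_lebL3BackwardLiouville C u p G hsw hwg hI hdec ⟨M, 0, hM, hgood⟩

end Summit.NavierStokesRegularity.NavierStokesRegularity.Theorems

end
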